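import Summits.Ventures.HSemireg.Transfer
import Literature.AlgebraicGeometry.HodgeTheory.WeilClassesSixfoldsProofs
import Literature.AlgebraicGeometry.HodgeTheory.LefschetzOneOneHolds
import Literature.AlgebraicGeometry.HodgeTheory.AlgebraicClassesCupAbelianVariety
import Literature.AlgebraicGeometry.HodgeTheory.HodgeRiemannDegreeOne
import Literature.AlgebraicGeometry.Motives.AbelianVarietyProjectiveChart
import Literature.AlgebraicGeometry.Motives.AbelianVarietyCohomologyExteriorH1
import HarnessLib

/-!
# Venture HSemireg — MARKMAN'S CLASS STATEMENT, as printed: «a semiregular object at ONE point whose `κ`-class has a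
# non-zero Weil part ⟹ the Weil classes are algebraic on the whole polarised Weil-type component» — the CLASS-LEVEL arrows

HONEST FRAMING. Lean index of the computation cell `pub-hsemireg` (seat p5, «Lean typer for the AMPLIFICATION CHAIN:
Markman's class statement AS PRINTED, with its hypotheses»). Nothing about any explicit variety is asserted; every
published input is cited, and everything below is PROVED from tree theorems (0 `sorry`, 0 definitions, 0 new named facts). Nothing here
says that HC, HC_CM or HC_AV is proved. Abelian fourfolds of Weil type are a THEOREM in print (Markman, J. Eur. Math. Soc. 25
(2023) Thm. 1.5 (= Thm. 13.4), p. 236, for discriminant 1 — «Thm. 1.3» in the pre-publication arXiv:1805.11574 numbering; for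
every imaginary quadratic `K` and EVERY discriminant only as a PREPRINT: arXiv:2502.03415 v2, §1.6, proof of Cor. 1.6.1,
FIRST SENTENCE (p. 9: «Theorem 1.5.1 implies that the Hodge-Weil classes are algebraic for every abelian fourfold of
Weil-type, for all imaginary quadratic number fields, and for all discriminants, …») = the fourfold half of [Mar25b] Thm. 1.2
below — whereas Cor. 1.6.1 ITSELF reads «The Hodge conjecture holds for abelian fourfolds.», a STRONGER statement (all of
`H^{2,2}`; its proof, p. 9 L20–36, assembles Thm. 1.5.1 with [S2, Prop. 10], [MZ1, Thm. 2.11], isogeny invariance, [R, Thm. 4.11]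
and [MZ3, Prop. 3.8, Thm. 0.1(i)]) that the cell does NOT re-derive and that no file of this seat types); the cell RE-DERIVES
split components at one CM point by semiregularity, and this file types the class-level half of that re-derivation in the
shape Markman prints it.

## The two printed passages (verbatim; `K` a CM field with totally real subfield `F`, `e = [K:ℚ]`, `d = dim_K H¹(A,ℚ)`,
## `HW(A,η) = ∧^d_K H¹(A,ℚ)` the `e`-dimensional space of Weil classes, `𝒜² ⊂ H^{1,1}(X×X̂,ℚ)` the `e/2`-dimensional
## space of classes staying Hodge on every Weil-type deformation)

[Mar25b] E. Markman, *Secant sheaves and Weil classes on abelian varieties*, arXiv:2509.23403 — a SURVEY, published: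
Proc. ICM 2026 Vol. 3 (SIAM, 2026) pp. 586–602, bib `Markman2026ICMSecant` (SIAM pagination/numbering not verified
against the arXiv text quoted here); the RESULTS it reports are proved in [Mar25], a PREPRINT — §4
«A strategy for proving the algebraicity of Weil classes», after the list (1) «Construct a complex multiplication
`η : K → End_ℚ(X×X̂)` … and an `η`-compatible polarization `h`», (2) «Construct a coherent sheaf `E` over `X×X̂` of
non-zero rank `r` satisfying: (a) `E` is semi-regular. (b) The class `κ(E) := ch(E)exp(−c₁(E)/r)` remains of Hodge type
under all deformations of `(X×X̂,η,h)` as a polarized abelian variety of Weil type. (c) The class `κ_{d/2}(E)` in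
`H^{d/2,d/2}(X×X̂,ℚ)` does not belong to the image of `Sym^{d/2}(𝒜²)`.»:

  «Conditions (a) and (b) and the Semi-regularity theorem imply that `κ(E)` remains algebraic on every polarized abelian
  variety of Weil type `(A,η′,h′)` in the connected component of moduli containing `(X×X̂,η,h)`. It follows that
  `κ_{d/2}(E)` belongs to the subspace `Im[Sym^{d/2}(𝒜²)] ⊕ HW(X×X̂,η)`, since these are the Hodge classes that remain of
  Hodge type on the generic abelian variety of Weil type, by Equation (1.1). It follows that `γ := κ_{d/2}(E) − δ` is a
  non-zero class in `HW(X×X̂,η)`, for some `δ ∈ Im[Sym^{d/2}(𝒜²)]`, by Condition (c). The class `γ` remains algebraic on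
  every `(A,η′,h′)` deformation equivalent to `(X×X̂,η,h)`, since `κ_{d/2}(E)` and `δ` do. Now `K` acts on `H^*(A,ℚ)` via
  algebraic correspondences and `HW(A,η′)` is 1-dimensional over `K`. Hence every class in `HW(A,η′)` is algebraic.»

  with Equation (1.1) (§1.1): «for a generic triple `(A,η,h)` in moduli,
  `H^{d/2,d/2}(A,ℚ) = Im[Sym^{d/2}(H^{1,1}(A,ℚ))] ⊕ HW(A,η)`».

[Mar25] E. Markman, *Cycles on abelian 2n-folds of Weil type from secant sheaves on abelian n-folds*, arXiv:2502.03415 v2,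
p. 88, «Proof of Theorem 1.5.1»: «The algebraicity of `κ₃(𝓑)` follows in a non-empty open subset in moduli from the
semiregularity of `𝓑`, proved in Lemma 9.3.11, and Conjecture 7.3.9 […]. The algebraicity of the Hodge-Weil classes
follows from that of `κ₃(𝓑)` and Theorem 1.4.1(4), since given a polarized abelian variety of Weil type `(A,η,h)` the
rational endomorphisms `η(K) ⊂ End_ℚ(A)` act on `H^*(A,ℚ)` via algebraic correspondences. The locus in moduli where the
Hodge-Weil classes are algebraic is a countable union of closed algebraic susbsets [voisin]. Hence, the locus contains
the whole irreducible component of moduli of deformations of `(X×X̂,η,h)`.» — with Thm. 1.4.1 (3) «The characteristic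
class `κ(𝓔) := exp(−c₁(𝓔)/rank(𝓔))ch(𝓔)` remains of Hodge type under every deformation of `(X×X̂,η,h)` as a polarized
abelian sixfold of Weil type», (4) «The `η(K)`-translates of the graded summand `κ₃(𝓔)` of `κ(𝓔)` in `H^{3,3}(X×X̂,ℚ)`,
together with `h³`, span the 3-dimensional subspace `ℚh³ ⊕ HŴ_P`», Cor. 1.3.2 («`κ(E)` is `Spin(V)_P`-invariant»),
Lemma 2.2.7 (v2 p. 16: «`(∧^{2j}V_ℚ)^{Spin(V)_P} ⊂ ∧^{j,j}V_ℂ`», of dimension `1` for `2j ≠ 2n` and `3` for `2j = 2n`) with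
Cor. 4.0.4 (v2 p. 27; numbered «Corollary 4.0.7» in the held e-print rendering), proof: «The subring `(∧^*(V_ℚ))^{Spin(V)_P}`
consists of the direct sum of the rational 2-dimensional subspace of Hodge-Weil classes in `∧^{2n}(V_ℚ)^{Spin(V)_P}` and the
space of powers of classes in the one-dimensional `∧²(V_ℚ)^{Spin(V)_P}`, by Lemma 2.2.7», and §1.3
(«`H²(X×X̂,ℚ)^{Spin(V)_P}` is one-dimensional spanned by an ample class `h` […] `η(k)` maps `h` to `Nm(k)h`»).

## What is typed here, arrow by arrow (tree vocabulary: `K = ℚ(√-d)` imaginary quadratic, i.e. `e = 2`, the Weil plane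
## `weilClassesOf A φ n d = HW ⊗ ℂ` of an abelian `2n`-fold `A` with `φ ≫ φ = -d`; `Im[Sym^{d/2}(𝒜²)] = ℚ·hⁿ` by §1.3)

* (companion file `MarkmanKappaShape.lean`, review-queued because it DEFINES a predicate)
  `IsMarkmanKappaShape n d P ψ₀ h I κ w` (PREDICATE, nothing asserted) — the CLASS-SIDE hypothesis in the form the
  printed argument actually uses it, for `e = 2`: the graded classes `κ_p`, `p ∈ I`, of the anchor object satisfy
  `κ_p ∈ ℚ·hᵖ` for `p ≠ n` and `κ_n = q·hⁿ + w` with `w` a NON-ZERO RATIONAL class of the Weil plane — i.e. [Mar25] Cor.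
  1.3.2 + Lemma 2.2.7 / Cor. 4.0.4 («`κ(𝓔) ∈ ℚ[h] ⊕ ĤW_P`») + Thm. 1.4.1(4) («Weil part `≠ 0`») = [Mar25b] (b)+(c) read
  through (1.1) = the cell's input (I3) of `theory/TH2-ASSEMBLY-NOTE-2PAGE.md` §0 (`ch₂(𝓔) = −h²/6 + w_re/6 + w_im/2`,
  `ch_k ∈ ℚ·hᵏ` else). These are exactly the class conjuncts of the assembly seat's `HasSeedOn` / `HasHyperbolicSeedOn` (p7); the
  rescaling lemmas `IsMarkmanKappaShape.smul` and `….symmetrised` (there) and `symmetrisedClass_eq_smul_of_map_eq` (§1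
  here) move a certificate stated in Markman's polarization `h` (`ψ₀^*h = d·h`, §1.3) to the tree's `K`-symmetrised
  hyperplane class `symmetrisedClass d P ψ₀ ι a = 2dm·h` (`Transfer.lean`), in which the Weil-anchor currency
  (`HasLocallyAlgebraicWeilAnchor`, `weilFamilyReach_hyperbolic`) is phrased.
* §2 the printed CLASS STATEMENT, POINTWISE on one `(A, φ)` (kernel-checked):
  `weilClassesOf_le_algebraicClasses_of_kappa` — «`γ := κ_{d/2} − δ` is a non-zero class in `HW` … `γ` algebraic since
  `κ_{d/2}` and `δ` are … `K` acts via algebraic correspondences and `HW` is 1-dimensional over `K`. Hence every class in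
  `HW(A,η′)` is algebraic»: `κ, δ ∈ algebraicClasses`, `κ − δ ∈ W_K ⊗ ℂ ∖ {0}` ⟹ `W_K ⊗ ℂ ≤ algebraicClasses` — by
  the tree's ONE-CLASS-SUFFICES `weilClassesOf_le_algebraicClasses_iff_exists_ne_zero_of_dim_eq` (the Weil plane is `E₊ ⊕ E₋`, both
  LINES by `H• = ⋀•H¹` = `Motives.abelianVarietyCohomologyExteriorH1_holds`, stable under the algebraic correspondences
  `(x·𝟙 + y·φ)^*` and swapped by complex conjugation); `cupPowTwo_mem_algebraicClasses_of_isRationalClass` — Markman's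
  `δ ∈ Im[Sym^{d/2}(𝒜²)]`, here `q·hⁿ` with `h` rational `(1,1)`, IS algebraic (Lefschetz `(1,1)`
  `lefschetzOneOne_rational_holds` + Kleiman moving on abelian varieties `AbelianVariety.cupProduct_mem_algebraicClasses_one`,
  both tree THEOREMS); `weilClassesOf_le_algebraicClasses_of_kappa_hpow` — the two combined: `κ = q·hⁿ + w` algebraic,
  `w ≠ 0` in the Weil plane ⟹ Weil plane algebraic (the companion file restates it from the predicate as
  `weilClassesOf_le_algebraicClasses_of_isMarkmanKappaShape`). The [Mar25] form via Thm. 1.4.1(4) («translates of `κ_n` and `hⁿ` SPAN `ℚhⁿ ⊕ HW`»)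
  is ALREADY the tree's `weilClassesOf_le_algebraicClasses_of_le_span_translates` (`WeilClassesSixfoldsProofs`) — cited,
  not re-declared.
* NOT typed here, and where it lives. (i) «the Semi-regularity theorem» (Buchweitz–Flenner Thm. 5.1 / Markman Conj. 7.3.9
  (§7.4) / Pridham / Perry) — seat p4 and the Literature facts `BuchweitzFlenner2003_variationalHodge_ISemiregular_model`,
  `BlochSemiregularSpread…`; (ii) «in the connected component of moduli containing `(X×X̂,η,h)`» + «countable union of closed
  algebraic subsets [voisin]» — the tree's Weil-anchor ENGINE (`WeilAnchorLocalClause`, `weilFamilyReach_hyperbolic`,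
  `Summit.HodgeConjecture.HodgeConjecture.WeilTypeLadder.weilClasses_algebraic_hyperbolic_of_localAnchor`: local clause at
  ONE hyperbolic anchor ∧ Deligne's reach ⟹ the Weil plane of EVERY hyperbolic member; Baire lemma
  `mem_algebraicClasses_of_isOpen_subset_algebraicityLocus` = Markman's [voisin] sentence) and the assembly seat p7's
  door-agnostic `AmplificationChainAssembly.lean`; (iii) Markman's (b) as a statement about ALL Weil-type deformations and
  Equation (1.1) itself (generic Mumford–Tate group `SU_H`, van Geemen Thm. 6.12 = tree `VanGeemen1994_thm612`,
  `IsDivisorWeilGenerated`): in the Weil-anchor currency they are SUBSUMED — `h` and `w ∈ W_K` are carried along every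
  Weil family as flat `(1,1)` / `(n,n)` data by the reach facts, which is all the printed argument uses of (b); (iv) the
  general CM-field form (`e > 2`, `𝒜²` of dimension `e/2`): the tree's Weil plane is imaginary-quadratic only —
  `-- TODO(general form): [Mar25b §4] for a CM field K ⊋ imaginary quadratic, HW(A,η) e-dimensional, δ ∈ Im Sym^{d/2}(𝒜²)`.

References: [Markman2025SecantWeil] arXiv:2502.03415 v2, §1.3, Cor. 1.3.2, Thm. 1.4.1, §1.5, Thm. 1.5.1 and its proof
p. 88, Lemma 2.2.7, Cor. 4.0.4 (preprint, unrefereed; theorem numbers of the public v2, page numbers of its PDF);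
[Markman2025SurveySecant] arXiv:2509.23403, §1.1 eq. (1.1), §2 Thm. 2.1, §4 (arXiv numbering; published form = [Markman2026ICMSecant],
a survey — the results it reports remain preprint, proofs in [Markman2025SecantWeil]); [vanGeemen1994HodgeAV] LNM 1594, 4.9,
Lemma 5.2, proof of Thm. 6.12; [VoisinHodgeI2002] Thm. 11.30 (Lefschetz (1,1)); [BuchweitzFlenner2003] Compositio 137,
Thm. 5.1.
-/

noncomputable section

open CategoryTheory AlgebraicGeometry

namespace Summit.Ventures.HSemireg

open Literature.AlgebraicGeometry Literature.AlgebraicGeometry.Motives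
open Literature.AlgebraicGeometry.HodgeTheory
open Literature.AlgebraicTopology.SingularHomology
open Summit.HodgeConjecture.HodgeConjecture.Theorems.HyperbolicEightfoldsSqrtMinus7.AnchorObject
  (cupPowTwo_mem_algebraicClasses_abelian)

/-! ## §1 Markman's polarization `h` (`η(k)^*h = Nm(k)·h`) vs. the tree's `K`-symmetrised hyperplane class -/

/-- **Markman's polarization vs. the tree's `K`-symmetrised class.** If the hyperplane class `ι^*a` of a projective
embedding is `m·h` and `ψ₀^*h = d·h` (Markman §1.3: «`η(k)` maps `h` to `Nm(k)h`», `Nm(√-d) = d`), then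
`symmetrisedClass d P ψ₀ ι a = d·ι^*a + ψ₀^*ι^*a = 2dm·h`. [cite: Markman2025SecantWeil, §1.3 (v2; preprint)]
[cite: vanGeemen1994HodgeAV, Lemma 5.2] -/
theorem symmetrisedClass_eq_smul_of_map_eq {d : ℕ} {P : AbelianVariety ℂ} {ψ₀ : P ⟶ P} (ι : ProjectiveEmbedding P.X)
    (a : complexBetti (projectiveSpace ι.n ℂ) 2) {h : complexBetti P.X 2} {m : ℚ}
    (hι : complexBetti.map ι.ι 2 a = ((m : ℚ) : ℂ) • h)
    (hψh : complexBetti.map ψ₀.hom.hom.hom 2 h = (d : ℂ) • h) :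
    symmetrisedClass d P ψ₀ ι a = (((2 * d * m : ℚ)) : ℂ) • h := by
  simp only [symmetrisedClass, hι, map_smul, hψh, smul_smul]
  rw [← add_smul]
  congr 1
  push_cast
  ring


/-! ## §2 The class statement, pointwise on one abelian `2n`-fold of `ℚ(√-d)`-Weil type -/

section Pointwise

variable {A : AbelianVariety ℂ} {n d : ℕ}

/-- **Markman's class statement, pointwise ([Mar25b] §4; [Mar25] proof of Thm. 1.5.1, p. 88).** On a complex abelian
`2n`-fold `A` with `φ ≫ φ = -d` (`n, d ≥ 1`): if `κ` and `δ` are ALGEBRAIC classes of degree `2n` («`κ_{d/2}(E)` remains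
algebraic … and `δ` do», `δ ∈ Im[Sym^{d/2}(𝒜²)]`) whose difference `γ := κ − δ` is a NON-ZERO class of the Weil plane
(Condition (c)), then EVERY class of the Weil plane `weilClassesOf A φ n d = HW ⊗ ℂ` is algebraic — «`K` acts on
`H^*(A,ℚ)` via algebraic correspondences and `HW(A,η′)` is 1-dimensional over `K`»: in the tree, the plane is the sum
of the two `φ^*`-eigenlines (`H• = ⋀•H¹`, `Motives.abelianVarietyCohomologyExteriorH1_holds`), the algebraic classes are
stable under the correspondences `(x·𝟙 + y·φ)^*` and under complex conjugation, and ONE non-zero algebraic class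
suffices (`weilClassesOf_le_algebraicClasses_iff_exists_ne_zero_of_dim_eq`).
[cite: Markman2025SurveySecant, §4 (the paragraph after conditions (a)–(c); arXiv numbering)]
[cite: Markman2026ICMSecant, §4 of the arXiv text (published ICM 2026 survey reporting it; proof = Markman2025SecantWeil, preprint)]
[cite: Markman2025SecantWeil, proof of Thm. 1.5.1 (v2 p. 88; preprint)] [cite: vanGeemen1994HodgeAV, proof of Thm. 6.12] -/
theorem weilClassesOf_le_algebraicClasses_of_kappa (hA : A.dim = 2 * n) (hn : 0 < n) (hd : 0 < d) {φ : A ⟶ A}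
    (hφ : φ ≫ φ = -(d • 𝟙 A)) {κ δ : complexBetti A.X (2 * n)} (hκ : κ ∈ algebraicClasses A.X n)
    (hδ : δ ∈ algebraicClasses A.X n) (hγW : κ - δ ∈ weilClassesOf A φ n d) (hγ0 : κ - δ ≠ 0) :
    weilClassesOf A φ n d ≤ algebraicClasses A.X n :=
  (weilClassesOf_le_algebraicClasses_iff_exists_ne_zero_of_dim_eq abelianVarietyCohomologyExteriorH1_holds hA hn hd
      hφ).2 ⟨κ - δ, hγW, Submodule.sub_mem _ hκ hδ, hγ0⟩

/-- **Markman's `δ ∈ Im[Sym^{d/2}(𝒜²)]` is algebraic** (`e = 2`: `𝒜² = ℚ·h`): on a complex abelian variety every cup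
power `hᵖ`, `p ≥ 1`, of a RATIONAL class `h` of Hodge type `(1,1)` is an algebraic class — Lefschetz `(1,1)`
(`lefschetzOneOne_rational_holds`, Voisin I Thm. 11.30, a tree THEOREM) and products with divisor classes on abelian
varieties (Kleiman moving by translations, the tree's `AbelianVariety.cupProduct_mem_algebraicClasses_one`, iterated in
`cupPowTwo_mem_algebraicClasses_abelian`). [cite: VoisinHodgeI2002, Thm. 11.30] [cite: Markman2025SurveySecant, §4]
[cite: Markman2026ICMSecant, §4 of the arXiv text (published survey; SIAM numbering not verified)] -/
theorem cupPowTwo_mem_algebraicClasses_of_isRationalClass {h : complexBetti A.X 2} (hh : IsRationalClass h)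
    (hh11 : IsOfHodgeType A.dim A.X 2 1 1 h) (p : ℕ) : cupPowTwo h (p + 1) ∈ algebraicClasses A.X (p + 1) :=
  cupPowTwo_mem_algebraicClasses_abelian A
    (lefschetzOneOne_rational_holds (AbelianVariety.isSmoothProjective_holds (A := A)) h hh hh11) p

/-- **Markman's class statement with `δ = q·hⁿ` ([Mar25b] §4 for `K` imaginary quadratic; [Mar25] p. 88 with Lemma
2.2.7 / Cor. 4.0.4).** On a complex abelian `2n`-fold `A` with `φ ≫ φ = -d` (`n, d ≥ 1`) and a rational `(1,1)` class `h`: if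
`κ ∈ H²ⁿ(A(ℂ); ℂ)` is ALGEBRAIC and `κ = q·hⁿ + w` with `w` a non-zero class of the Weil plane, then the whole Weil
plane is algebraic. [cite: Markman2025SurveySecant, §4] [cite: Markman2026ICMSecant, §4 of the arXiv text (published survey)]
[cite: Markman2025SecantWeil, proof of Thm. 1.5.1 (v2 p. 88; preprint)] -/
theorem weilClassesOf_le_algebraicClasses_of_kappa_hpow (hA : A.dim = 2 * n) (hn : 0 < n) (hd : 0 < d) {φ : A ⟶ A}
    (hφ : φ ≫ φ = -(d • 𝟙 A)) {h : complexBetti A.X 2} (hh : IsRationalClass h) (hh11 : IsOfHodgeType A.dim A.X 2 1 1 h)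
    {κ w : complexBetti A.X (2 * n)} (hκ : κ ∈ algebraicClasses A.X n) {q : ℚ}
    (hκw : κ = ((q : ℚ) : ℂ) • cupPowTwo h n + w) (hwW : w ∈ weilClassesOf A φ n d) (hw0 : w ≠ 0) :
    weilClassesOf A φ n d ≤ algebraicClasses A.X n := by
  obtain ⟨m, rfl⟩ : ∃ m, n = m + 1 := ⟨n - 1, by omega⟩
  have hδ : ((q : ℚ) : ℂ) • cupPowTwo h (m + 1) ∈ algebraicClasses A.X (m + 1) :=
    Submodule.smul_mem _ _ (cupPowTwo_mem_algebraicClasses_of_isRationalClass hh hh11 m)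
  have hγ : κ - ((q : ℚ) : ℂ) • cupPowTwo h (m + 1) = w := by rw [hκw, add_sub_cancel_left]
  exact weilClassesOf_le_algebraicClasses_of_kappa hA hn hd hφ hκ hδ (hγ ▸ hwW) (hγ ▸ hw0)

end Pointwise

end Summit.Ventures.HSemireg

end
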